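import Summits.BirchSwinnertonDyer.Rank1Residual.Supersingular.X7ToricPeriodUnitClass
import Summits.BirchSwinnertonDyer.Rank1Residual.Supersingular.KobayashiEquivalenceRankZero
import HarnessLib

/-!
# The (A3) avatar `X7.ToricPeriodUnitAt W p` implies KOBAYASHI'S SIGNED MAIN CONJECTURE at the pair,
# BOTH signs, in analytic rank `0` (cell `bsd-ssimc`, seat `bsd-ssimc-lev` gen 5, item (I3), part 5)

PARTITION (cell bsd-ssimc): X7 (A7) r0 × p ≥ 5 × Surj (and verbatim X6 r0 × p ≥ 5) — types-the-object-of;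
closes NONE. THEOREMS ONLY (no definition, no named fact; nothing about any curve is asserted).

Gen 3 landed the class-level consumer `X7.bsdp_of_toricPeriodUnitAt_of_analyticRank_eq_zero'`
(`X7ToricPeriodUnitClass.lean`, p410227): PUBLISHED facts + `p ≥ 5` good, `ρ̄_{E,p}` onto,
`r_an = 0`, `E` optimal with `p ∤ c` + the typed input `X7.ToricPeriodUnitAt W p` (a UNIT level-raised
toric period of the definite bipartite family, Kim 2024 Thm. 5.23) ⇒ `BSD(E,p)`. The cell
`b2b-bsdres` landed the rank-zero CONVERSE on the real ± objects
(`kobayashiMainConjecture_of_bsdp_of_analyticRank_eq_zero`, `KobayashiConverseReal.lean`): `p` odd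
good, `a_p = 0`, `ρ̄` onto, `r_an = 0`, `BSD(E,p)` ⇒ `KobayashiMainConjecture W p ε` for EITHER sign
(Kobayashi Thm. 1.2 + Thm. 4.1 (Kato side, integral under surjectivity) + B. D. Kim Cor. 3.15 +
Pollack: the cofactor of `ξ ∣ L^ε` is a unit of `Λ` because it is a unit at `T = 0` — `Λ` is local).
This file COMPOSES the two: on the (A3) road the seat's typed input does not merely "support" the
route's cruxes by name, it CONCLUDES their predicates at every pair it reaches:

* `kobayashiMainConjecture_of_toricPeriodUnitAt_of_analyticRank_eq_zero` — class-free: `p ≥ 5` good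
  (`a_p = 0` by Hasse from `p ∣ a_p`), `ρ̄` onto, `r_an = 0`, optimal `E` with `p ∤ c`,
  `X7.ToricPeriodUnitAt W p` ⇒ `∀ ε, KobayashiMainConjecture W p ε`;
* `X7.kobayashiMainConjecture_of_toricPeriodUnitAt_of_analyticRank_eq_zero`,
  `X7.kobayashiLowerDivisibility_of_toricPeriodUnitAt_of_analyticRank_eq_zero` — the X7 readings: the
  conclusion of crux `KobayashiLowerHalfLargeImage` (route `SignedLowerHalves`, item
  stmt-BirchSwinnertonDyer-19001: `∃ ε, KobayashiLowerDivisibility W p ε`) AND of crux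
  `KobayashiMainConjectureSmallImage`'s predicate shape (the full equality), on X7 ∧ r0 ∧ p ≥ 5 ∧ Surj ∧ optimal;
* `X6.kobayashiMainConjecture_of_toricPeriodUnitAt_of_analyticRank_eq_zero` — the X6 reading (the
  definite road does not see the additive part of `N⁺`, MEMO-4-addA §A.3): the conclusion of crux
  `KobayashiLowerHalfSemistable` (stmt-BirchSwinnertonDyer-19000) on X6 ∧ r0 ∧ p ≥ 5 ∧ optimal.

So for rank-0 pairs the (A3) atom is EQUIVALENT in the kernel to the signed main conjecture at the
pair (converse: `X7.bsdp_iff_kobayashiLowerDivisibility_of_surj_of_analyticRank_eq_zero` ∘ the gen-3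
consumer), i.e. the definite bipartite road is a LINE for cruxes 2/3 on their r0 ∧ p ≥ 5 ∧ Surj parts,
not only a support. PER PAIR in its inputs; nothing booked; the avatar stays an OPEN typed input.

References: [Kim2024] Thm. 5.23; [CaiShuTian2014] Thm. 1.2; [WZhang2014] Thm. 6.4; [Kobayashi2003]
Thm. 1.2, Thm. 4.1, Conjecture (p. 2); [BDKim2013] Cor. 3.15; [Wuthrich2014] Lemma 20, Prop. 21;
[Miller2011LMS] Def. 1.1.
-/

noncomputable section

open scoped Classical

open WeierstrassCurve Literature.NumberTheory.EllipticCurves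
  Literature.NumberTheory.EllipticCurves.ModularForms
  Literature.NumberTheory.EllipticCurves.Rank1Residual
  Literature.NumberTheory.EllipticCurves.Rank1Residual.Typed
  Literature.NumberTheory.EllipticCurves.CaiShuTian2014
  Literature.NumberTheory.EllipticCurves.Kim2024
  Literature.NumberTheory.EllipticCurves.Wuthrich2014
  Literature.NumberTheory.EllipticCurves.Kobayashi2003
  Literature.NumberTheory.Automorphic

namespace Summit.BirchSwinnertonDyer.Rank1Residual.Supersingular

/-- **The (A3) avatar ⇒ Kobayashi's signed main conjecture at the pair, both signs (rank 0).**
Let `p ≥ 5` be a prime of good reduction of `E = W` with `p ∣ a_p` (so `a_p = 0`), `ρ̄_{E,p}` onto,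
`ord_{s=1} L(E,s) = 0`, `Dt` an OPTIMAL modular parametrisation with `p ∤ c(Dt)`, and assume the typed
input `X7.ToricPeriodUnitAt W p`. Granted BY NAME the published facts of the gen-3 consumer (Kim 2024
Thm. 5.23 `hKim`, Cai–Shu–Tian Thm. 1.2 `hCST`, W. Zhang Thm. 6.4 `hZ`, ARS 2.1 `hARS`, GZK `hGZK`,
modularity `hmod`, Wuthrich Prop. 21 `hWu`) and of the rank-zero converse (Kobayashi Thm. 1.2 `h12`,
Thm. 4.1 `h41`, B. D. Kim Cor. 3.15 `hBDK`, the period-unit facts `h5`, `h3`, Wuthrich Lemma 20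
`hL20`): `KobayashiMainConjecture W p ε` for every sign `ε`. Proof: `BSD(E,p)` by
`X7.bsdp_of_toricPeriodUnitAt_of_analyticRank_eq_zero'`, then
`kobayashiMainConjecture_of_bsdp_of_analyticRank_eq_zero`. PER PAIR; nothing asserted beyond the binders.
[cite: Kim2024, Thm. 5.23] [cite: Kobayashi2003, Thm. 1.2, Thm. 4.1 and Conjecture (p. 2)]
[cite: BDKim2013, Cor. 3.15 (p. 199)] [cite: Wuthrich2014, Prop. 21 (p. 400)] -/
theorem kobayashiMainConjecture_of_toricPeriodUnitAt_of_analyticRank_eq_zero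
    (hKim : thm523_natCard_selmerGroupPInfty_eq_pow_of_unitToricPeriod)
    (hCST : thm12_trivialChar) (hZ : WZhang2014.thm64_padicValNat_congruenceNumber_eq)
    (hARS : padicValNat_congruenceNumber_eq_of_not_sq_dvd)
    (hGZK : rank_eq_analyticRank_of_analyticRank_le_one) (hmod : hasEntireLFunction_rat)
    (hWu : sha_dvd_analyticSha)
    (h12 : Kobayashi2003.thm12_signedSelmerDual_finite_torsion)
    (h41 : Kobayashi2003.thm41_signedCharIdeal_divisibility)
    (hBDK : BDKim2013.cor315_signedCharValue_rankZero)
    (h5 : realPeriodRat_eq_unit_mul_plusPeriod) (h3 : realPeriodRat_eq_unit_mul_plusPeriod_three)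
    (hL20 : Wuthrich2014.lemma20_surjective_threeAdic_of_semistable)
    (W : WeierstrassCurve ℚ) [W.IsElliptic] [W.IsGloballyMinimal] [NeZero (W.conductorNorm ℤ)]
    (p : ℕ) [Fact p.Prime] (hp5 : 5 ≤ p) (hgood : W.HasGoodReductionAtPrime p)
    (hss : (p : ℤ) ∣ W.frobeniusTrace p)
    (hsurj : W.HasSurjectiveModNGaloisRep (p : ℤ)) (hr : W.analyticRank = 0)
    (Dt : ModularParametrizationData W (W.conductorNorm ℤ))
    (hopt : ∀ (W' : WeierstrassCurve ℚ) [W'.IsElliptic]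
      (D' : ModularParametrizationData W' (W.conductorNorm ℤ)), D'.f = Dt.f → Dt.modularDegree ≤ D'.modularDegree)
    (hc : ¬ (p : ℤ) ∣ Dt.c) (h : X7.ToricPeriodUnitAt W p) (ε : ℤˣ) :
    KobayashiMainConjecture W p ε := by
  have hp2 : p ≠ 2 := by omega
  have hap : W.frobeniusTrace p = 0 := (W.natCast_dvd_frobeniusTrace_iff_eq_zero p hp5 hgood).mp hss
  have hB : BSDp W p :=
    X7.bsdp_of_toricPeriodUnitAt_of_analyticRank_eq_zero' hKim hCST hZ hARS hGZK hmod hWu W p hp5 hgood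
      hsurj hr Dt hopt hc h
  exact kobayashiMainConjecture_of_bsdp_of_analyticRank_eq_zero W p h12 h41 hBDK h5 h3 hL20 hGZK hmod
    hp2 hgood hap hsurj hr hB ε

/-- **X7 ∧ r_an = 0 ∧ p ≥ 5 ∧ Surj: the (A3) avatar ⇒ Kobayashi's main conjecture for `(E, p, ε)`,
both signs** — the predicate of crux `KobayashiMainConjectureSmallImage` / the equality form behind crux
`KobayashiLowerHalfLargeImage` of route `SignedLowerHalves`, concluded (not assumed) on this sub-class
from the typed input `X7.ToricPeriodUnitAt W p` + published facts + optimality with `p ∤ c`.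
(`a_p = 0` by Hasse on X7 at `p ≥ 5`.) PER PAIR. [cite: Kim2024, Thm. 5.23]
[cite: Kobayashi2003, Thm. 4.1 and Conjecture (p. 2)] [cite: BDKim2013, Cor. 3.15 (p. 199)] -/
theorem X7.kobayashiMainConjecture_of_toricPeriodUnitAt_of_analyticRank_eq_zero
    (hKim : thm523_natCard_selmerGroupPInfty_eq_pow_of_unitToricPeriod)
    (hCST : thm12_trivialChar) (hZ : WZhang2014.thm64_padicValNat_congruenceNumber_eq)
    (hARS : padicValNat_congruenceNumber_eq_of_not_sq_dvd)
    (hGZK : rank_eq_analyticRank_of_analyticRank_le_one) (hmod : hasEntireLFunction_rat)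
    (hWu : sha_dvd_analyticSha)
    (h12 : Kobayashi2003.thm12_signedSelmerDual_finite_torsion)
    (h41 : Kobayashi2003.thm41_signedCharIdeal_divisibility)
    (hBDK : BDKim2013.cor315_signedCharValue_rankZero)
    (h5 : realPeriodRat_eq_unit_mul_plusPeriod) (h3 : realPeriodRat_eq_unit_mul_plusPeriod_three)
    (hL20 : Wuthrich2014.lemma20_surjective_threeAdic_of_semistable)
    (W : WeierstrassCurve ℚ) [W.IsElliptic] [W.IsGloballyMinimal] [NeZero (W.conductorNorm ℤ)]
    (p : ℕ) [Fact p.Prime] (hp5 : 5 ≤ p) (hX : ClassX7 W p) (hsurj : Surj W p)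
    (hr : W.analyticRank = 0) (Dt : ModularParametrizationData W (W.conductorNorm ℤ))
    (hopt : ∀ (W' : WeierstrassCurve ℚ) [W'.IsElliptic]
      (D' : ModularParametrizationData W' (W.conductorNorm ℤ)), D'.f = Dt.f → Dt.modularDegree ≤ D'.modularDegree)
    (hc : ¬ (p : ℤ) ∣ Dt.c) (h : X7.ToricPeriodUnitAt W p) (ε : ℤˣ) :
    KobayashiMainConjecture W p ε :=
  _root_.Summit.BirchSwinnertonDyer.Rank1Residual.Supersingular.kobayashiMainConjecture_of_toricPeriodUnitAt_of_analyticRank_eq_zero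
    hKim hCST hZ hARS hGZK hmod hWu
    h12 h41 hBDK h5 h3 hL20 W p hp5 hX.1.1 hX.1.2 hsurj hr Dt hopt hc h ε

/-- **X7 ∧ r_an = 0 ∧ p ≥ 5 ∧ Surj: the (A3) avatar ⇒ the Eisenstein half of Kobayashi's main
conjecture for SOME sign** — literally the conclusion `∃ ε, KobayashiLowerDivisibility W p ε` of crux
`KobayashiLowerHalfLargeImage` (route `SignedLowerHalves`, item stmt-BirchSwinnertonDyer-19001) at the
pair (indeed for every sign, `kobayashiLowerDivisibility_of_mainConjecture`). PER PAIR.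
[cite: Kim2024, Thm. 5.23] [cite: Kobayashi2003, Conjecture (p. 2)] -/
theorem X7.kobayashiLowerDivisibility_of_toricPeriodUnitAt_of_analyticRank_eq_zero
    (hKim : thm523_natCard_selmerGroupPInfty_eq_pow_of_unitToricPeriod)
    (hCST : thm12_trivialChar) (hZ : WZhang2014.thm64_padicValNat_congruenceNumber_eq)
    (hARS : padicValNat_congruenceNumber_eq_of_not_sq_dvd)
    (hGZK : rank_eq_analyticRank_of_analyticRank_le_one) (hmod : hasEntireLFunction_rat)
    (hWu : sha_dvd_analyticSha)
    (h12 : Kobayashi2003.thm12_signedSelmerDual_finite_torsion)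
    (h41 : Kobayashi2003.thm41_signedCharIdeal_divisibility)
    (hBDK : BDKim2013.cor315_signedCharValue_rankZero)
    (h5 : realPeriodRat_eq_unit_mul_plusPeriod) (h3 : realPeriodRat_eq_unit_mul_plusPeriod_three)
    (hL20 : Wuthrich2014.lemma20_surjective_threeAdic_of_semistable)
    (W : WeierstrassCurve ℚ) [W.IsElliptic] [W.IsGloballyMinimal] [NeZero (W.conductorNorm ℤ)]
    (p : ℕ) [Fact p.Prime] (hp5 : 5 ≤ p) (hX : ClassX7 W p) (hsurj : Surj W p)
    (hr : W.analyticRank = 0) (Dt : ModularParametrizationData W (W.conductorNorm ℤ))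
    (hopt : ∀ (W' : WeierstrassCurve ℚ) [W'.IsElliptic]
      (D' : ModularParametrizationData W' (W.conductorNorm ℤ)), D'.f = Dt.f → Dt.modularDegree ≤ D'.modularDegree)
    (hc : ¬ (p : ℤ) ∣ Dt.c) (h : X7.ToricPeriodUnitAt W p) :
    ∃ ε : ℤˣ, KobayashiLowerDivisibility W p ε :=
  ⟨1, kobayashiLowerDivisibility_of_mainConjecture
    (X7.kobayashiMainConjecture_of_toricPeriodUnitAt_of_analyticRank_eq_zero hKim hCST hZ hARS hGZK hmod
      hWu h12 h41 hBDK h5 h3 hL20 W p hp5 hX hsurj hr Dt hopt hc h 1)⟩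

/-- **X6 ∧ r_an = 0 ∧ p ≥ 5: the (A3) avatar ⇒ Kobayashi's main conjecture for `(E, p, ε)`, both
signs** — the definite bipartite road does not read the additive part of the conductor, so the same
typed input `X7.ToricPeriodUnitAt W p` (its name notwithstanding) + published facts + optimality with
`p ∤ c` CONCLUDE the predicate behind crux `KobayashiLowerHalfSemistable` (stmt-BirchSwinnertonDyer-19000)
at a semistable rank-0 pair with `p ≥ 5` (surjectivity is automatic on X6: `ClassX6.surj`; `a_p = 0`:
`ClassX6.frobeniusTrace_eq_zero`). PER PAIR. [cite: Kim2024, Thm. 5.23]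
[cite: Kobayashi2003, Thm. 4.1 and Conjecture (p. 2)] [cite: Serre1972, §5.4 Prop. 21 i)] -/
theorem X6.kobayashiMainConjecture_of_toricPeriodUnitAt_of_analyticRank_eq_zero
    (hKim : thm523_natCard_selmerGroupPInfty_eq_pow_of_unitToricPeriod)
    (hCST : thm12_trivialChar) (hZ : WZhang2014.thm64_padicValNat_congruenceNumber_eq)
    (hARS : padicValNat_congruenceNumber_eq_of_not_sq_dvd)
    (hGZK : rank_eq_analyticRank_of_analyticRank_le_one) (hmod : hasEntireLFunction_rat)
    (hWu : sha_dvd_analyticSha)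
    (h12 : Kobayashi2003.thm12_signedSelmerDual_finite_torsion)
    (h41 : Kobayashi2003.thm41_signedCharIdeal_divisibility)
    (hBDK : BDKim2013.cor315_signedCharValue_rankZero)
    (h5 : realPeriodRat_eq_unit_mul_plusPeriod) (h3 : realPeriodRat_eq_unit_mul_plusPeriod_three)
    (hL20 : Wuthrich2014.lemma20_surjective_threeAdic_of_semistable)
    (W : WeierstrassCurve ℚ) [W.IsElliptic] [W.IsGloballyMinimal] [NeZero (W.conductorNorm ℤ)]
    (p : ℕ) [Fact p.Prime] (hp5 : 5 ≤ p) (hX : ClassX6 W p)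
    (hr : W.analyticRank = 0) (Dt : ModularParametrizationData W (W.conductorNorm ℤ))
    (hopt : ∀ (W' : WeierstrassCurve ℚ) [W'.IsElliptic]
      (D' : ModularParametrizationData W' (W.conductorNorm ℤ)), D'.f = Dt.f → Dt.modularDegree ≤ D'.modularDegree)
    (hc : ¬ (p : ℤ) ∣ Dt.c) (h : X7.ToricPeriodUnitAt W p) (ε : ℤˣ) :
    KobayashiMainConjecture W p ε := by
  have hp2 : p ≠ 2 := by omega
  have hap : W.frobeniusTrace p = 0 := ClassX6.frobeniusTrace_eq_zero W p hp2 hX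
  have hss : (p : ℤ) ∣ W.frobeniusTrace p := by rw [hap]; exact dvd_zero _
  exact _root_.Summit.BirchSwinnertonDyer.Rank1Residual.Supersingular.kobayashiMainConjecture_of_toricPeriodUnitAt_of_analyticRank_eq_zero
    hKim hCST hZ hARS hGZK hmod hWu h12 h41 hBDK h5 h3 hL20 W p hp5 hX.1.1 hss (ClassX6.surj W p hp2 hX) hr
    Dt hopt hc h ε

end Summit.BirchSwinnertonDyer.Rank1Residual.Supersingular

end
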